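import Literature.NumberTheory.EllipticCurves.SerreOpenImageSupersingularInertiaProofs
import Literature.NumberTheory.EllipticCurves.SerreOpenImageTameKummerProofs
import Literature.NumberTheory.EllipticCurves.Rank1Residual.AnomalousDictionaryProofs
import Literature.NumberTheory.EllipticCurves.Rank1Residual.EisensteinGoodComplement
import HarnessLib

/-!
# At an odd prime of good SUPERSINGULAR reduction `E[p]` is irreducible (Serre 1972, §1.11 Prop. 12);
# hence a good Eisenstein prime `p > 2` is ordinary, and the "anomalous" dictionary holds on exactly
# the scope of Castella–Grossi–Skinner 2025 (`p > 2`, `good(p)`, `red(p)`)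

`Proofs`-style file (THEOREMS ONLY: no definition, no named fact, no instance), topic
`NumberTheory/EllipticCurves`, cell `b2b-bsdres` (run/shared/lean/b2b/bsd-rank1-residual/), HONEST
FRAMING: the cell deletes the COMBINATION-SHAPED residual classes of the rank-`≤ 1` BSD formula from
PUBLISHED theorems only and types the rest; this is not "finishing BSD".

* `hasIrreducibleModPGaloisRep_of_dvd_frobeniusTrace` — for `W/ℚ` globally minimal elliptic and an
  odd prime `p ∤ Δ_W` with `p ∣ a_p`: `E[p]` is an irreducible `Γ_ℚ`-module. Serre, Invent. Math. 15
  (1972) §1.11 Prop. 12: at a supersingular place the inertia group acts on `E[p]` through a cyclic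
  group of order `p² - 1` (the tree's `isCyclic_and_card_inertia_map_of_dvd_frobeniusTrace`, with the
  tame Kummer input `exists_mem_inertia_smul_eq_mul_of_pow_eq`); a generator `ρ̄(τ)` stabilising a
  line `Φ` would act on `Φ` and on `E[p]/Φ` by scalars, so `ρ̄(τ)^{p-1}` would be unipotent, of order
  dividing `p`, forcing `p² - 1 ∣ p(p - 1)` — absurd.
* `Rank1Residual.goodOrd_of_red_of_good` — **`2 < p`, `good(p)`, `red(p)` ⇒ `ord(p)`** (the sentence
  "red(p) ∧ good(p) ∧ p > 2 ⇒ ord(p)" of RESIDUAL-CASES §a.1 C6, which `Predicates.lean` proved only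
  in the anomalous case `goodOrd_of_anom`).
* `Rank1Residual.anom_iff_decomposition_of_red`, `Rank1Residual.not_anom_iff_cgs_of_red` — the
  dictionary of `AnomalousDictionaryProofs` on EXACTLY the scope of CGS 2025 Thm. A/D: for `2 < p`,
  `good(p)` and a rational line `Φ` (⇒ `red(p)`), `¬ Anom W p` iff the decomposition group at the
  place's prime neither fixes `Φ` pointwise nor acts trivially on `E[p]/Φ` ("`φ|_{G_p} ≠ 1, ω`").

References: [Serre1972] §1.3 Prop. 1–2, §1.11 Prop. 12; [CastellaGrossiSkinner2025] Thm. A, §0 p. 3.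
-/

set_option autoImplicit false

noncomputable section

open scoped Classical NumberField Pointwise

open WeierstrassCurve Literature.NumberTheory.GaloisRepresentations Field IsDedekindDomain NumberField
  Rat.HeightOneSpectrum

namespace Literature.NumberTheory.EllipticCurves

variable {W : WeierstrassCurve ℚ} [W.IsElliptic] {p : ℕ} [Fact p.Prime]

/-! ### A stable line and its quotient: the stabiliser acts by scalars -/

omit [W.IsElliptic] in
/-- A subgroup of prime order `p` is generated by each of its non-zero elements. [folklore] -/
theorem eq_zmultiples_of_card_eq_prime {Φ : AddSubgroup (geomTorsion W (p : ℤ))}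
    (hΦ : Nat.card Φ = p) {P₀ : geomTorsion W (p : ℤ)} (hP₀ : P₀ ∈ Φ) (hP₀0 : P₀ ≠ 0) :
    Φ = AddSubgroup.zmultiples P₀ := by
  have hp : p.Prime := Fact.out
  haveI : Finite Φ := Nat.finite_of_card_ne_zero (by rw [hΦ]; exact hp.ne_zero)
  have hle : AddSubgroup.zmultiples P₀ ≤ Φ := (AddSubgroup.zmultiples_le).mpr hP₀
  have hdvd : Nat.card (AddSubgroup.zmultiples P₀) ∣ p := by
    have h := AddSubgroup.card_dvd_of_le hle
    rwa [hΦ] at h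
  rcases (Nat.dvd_prime hp).mp hdvd with h1 | h2
  · exfalso
    haveI : Finite (AddSubgroup.zmultiples P₀) := Finite.of_injective _
      (AddSubgroup.inclusion_injective hle)
    have := AddSubgroup.eq_bot_of_card_eq _ h1
    rw [AddSubgroup.zmultiples_eq_bot] at this
    exact hP₀0 this
  · exact (AddSubgroup.eq_of_le_of_card_ge hle (by rw [hΦ, h2])).symm

omit [W.IsElliptic] in
/-- **`σ` acts on a stable line by a scalar**: if `σ Φ ⊆ Φ` with `#Φ = p` then there is `k : ℤ` with
`σ • P = k • P` for all `P ∈ Φ`. [folklore] -/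
theorem exists_smul_eq_zsmul_of_stable {Φ : AddSubgroup (geomTorsion W (p : ℤ))}
    (hΦ : Nat.card Φ = p) {σ : absoluteGaloisGroup ℚ} (hstab : ∀ P ∈ Φ, σ • P ∈ Φ) :
    ∃ k : ℤ, ∀ P ∈ Φ, σ • P = k • P := by
  have hp : p.Prime := Fact.out
  haveI : Finite Φ := Nat.finite_of_card_ne_zero (by rw [hΦ]; exact hp.ne_zero)
  have hnt : 1 < Nat.card Φ := by rw [hΦ]; exact hp.one_lt
  haveI : Nontrivial Φ := Finite.one_lt_card_iff_nontrivial.mp hnt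
  obtain ⟨⟨P₀, hP₀⟩, hP₀0⟩ := exists_ne (0 : Φ)
  have hP₀0' : P₀ ≠ 0 := fun h ↦ hP₀0 (Subtype.ext h)
  have hgen := eq_zmultiples_of_card_eq_prime hΦ hP₀ hP₀0'
  obtain ⟨k, hk⟩ := AddSubgroup.mem_zmultiples_iff.mp (hgen ▸ hstab P₀ hP₀)
  refine ⟨k, fun P hP ↦ ?_⟩
  obtain ⟨m, rfl⟩ := AddSubgroup.mem_zmultiples_iff.mp (hgen ▸ hP)
  rw [show σ • (m • P₀) = m • (σ • P₀) from map_zsmul (DistribSMul.toAddMonoidHom _ σ) m P₀,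
    ← hk, smul_comm]

omit [W.IsElliptic] in
/-- **`σ` acts on the quotient by a stable line by a scalar**: if `σ Φ ⊆ Φ`, `#Φ = p`, `#E[p] = p²`,
there is `d : ℤ` with `σ • P - d • P ∈ Φ` for all `P`. [folklore] -/
theorem exists_smul_sub_zsmul_mem_of_stable {Φ : AddSubgroup (geomTorsion W (p : ℤ))}
    (hΦ : Nat.card Φ = p) (hE : Nat.card (geomTorsion W (p : ℤ)) = p ^ 2)
    {σ : absoluteGaloisGroup ℚ} (hstab : ∀ P ∈ Φ, σ • P ∈ Φ) :
    ∃ d : ℤ, ∀ P : geomTorsion W (p : ℤ), σ • P - d • P ∈ Φ := by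
  have hp : p.Prime := Fact.out
  haveI : Finite (geomTorsion W (p : ℤ)) :=
    Nat.finite_of_card_ne_zero (by rw [hE]; exact pow_ne_zero 2 hp.ne_zero)
  -- the quotient has order `p`
  have hq : Nat.card (geomTorsion W (p : ℤ) ⧸ Φ) = p := by
    have h := Φ.card_eq_card_quotient_mul_card_addSubgroup
    rw [hE, hΦ, pow_two] at h
    exact (Nat.eq_of_mul_eq_mul_right hp.pos h).symm
  -- a point outside `Φ`
  have hΦtop : Φ ≠ ⊤ := fun h ↦ by
    have := hΦ; rw [h, AddSubgroup.card_top, hE, pow_two] at this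
    exact absurd this (by nlinarith [hp.one_lt])
  obtain ⟨Q₀, hQ₀⟩ : ∃ Q₀ : geomTorsion W (p : ℤ), Q₀ ∉ Φ := by
    by_contra h
    push Not at h
    exact hΦtop (eq_top_iff.mpr fun x _ ↦ h x)
  -- its class generates the quotient
  have hq0 : (QuotientAddGroup.mk Q₀ : geomTorsion W (p : ℤ) ⧸ Φ) ≠ 0 := fun h ↦
    hQ₀ ((QuotientAddGroup.eq_zero_iff Q₀).mp h)
  haveI : Finite (geomTorsion W (p : ℤ) ⧸ Φ) := Nat.finite_of_card_ne_zero (by rw [hq]; exact hp.ne_zero)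
  have hgen : (⊤ : AddSubgroup (geomTorsion W (p : ℤ) ⧸ Φ)) =
      AddSubgroup.zmultiples (QuotientAddGroup.mk Q₀) := by
    have hle : AddSubgroup.zmultiples (QuotientAddGroup.mk Q₀ : geomTorsion W (p : ℤ) ⧸ Φ) ≤ ⊤ :=
      le_top
    have hdvd : Nat.card (AddSubgroup.zmultiples (QuotientAddGroup.mk Q₀ : geomTorsion W (p : ℤ) ⧸ Φ))
        ∣ p := by
      have h := AddSubgroup.card_dvd_of_le hle
      rwa [AddSubgroup.card_top, hq] at h
    rcases (Nat.dvd_prime hp).mp hdvd with h1 | h2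
    · exfalso
      have := AddSubgroup.eq_bot_of_card_eq _ h1
      rw [AddSubgroup.zmultiples_eq_bot] at this
      exact hq0 this
    · exact (AddSubgroup.eq_of_le_of_card_ge hle (by rw [h2, AddSubgroup.card_top, hq])).symm
  have hmemq : ∀ x : geomTorsion W (p : ℤ) ⧸ Φ,
      x ∈ AddSubgroup.zmultiples (QuotientAddGroup.mk Q₀ : geomTorsion W (p : ℤ) ⧸ Φ) :=
    fun x ↦ hgen ▸ AddSubgroup.mem_top x
  -- the scalar `d`
  obtain ⟨d, hd⟩ := AddSubgroup.mem_zmultiples_iff.mp (hmemq (QuotientAddGroup.mk (σ • Q₀)))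
  have hd' : σ • Q₀ - d • Q₀ ∈ Φ := by
    rw [← QuotientAddGroup.eq_iff_sub_mem, QuotientAddGroup.mk_zsmul]; exact hd.symm
  refine ⟨d, fun P ↦ ?_⟩
  obtain ⟨a, ha⟩ := AddSubgroup.mem_zmultiples_iff.mp (hmemq (QuotientAddGroup.mk P))
  have haP : P - a • Q₀ ∈ Φ := by
    rw [← QuotientAddGroup.eq_iff_sub_mem, QuotientAddGroup.mk_zsmul]; exact ha.symm
  -- `σ P - d P = σ (P - a Q₀) + a (σ Q₀ - d Q₀) - d (P - a Q₀)`
  have hcalc : σ • P - d • P =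
      σ • (P - a • Q₀) + a • (σ • Q₀ - d • Q₀) - d • (P - a • Q₀) := by
    rw [smul_sub, show σ • (a • Q₀) = a • (σ • Q₀) from
      map_zsmul (DistribSMul.toAddMonoidHom _ σ) a Q₀, zsmul_sub, zsmul_sub, smul_smul,
      smul_smul, mul_comm a d]
    abel
  rw [hcalc]
  exact Φ.sub_mem (Φ.add_mem (hstab _ haP) (Φ.zsmul_mem hd' a)) (Φ.zsmul_mem haP d)

/-! ### Powers and unipotence -/

omit [W.IsElliptic] [Fact p.Prime] in
/-- Iterating a scalar action on a stable subgroup: `σⁿ • P = kⁿ • P` on `Φ`. [folklore] -/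
theorem pow_smul_eq_pow_zsmul {Φ : AddSubgroup (geomTorsion W (p : ℤ))} {σ : absoluteGaloisGroup ℚ}
    {k : ℤ} (hk : ∀ P ∈ Φ, σ • P = k • P) (n : ℕ) : ∀ P ∈ Φ, (σ ^ n) • P = (k ^ n) • P := by
  induction n with
  | zero => intro P _; rw [pow_zero, pow_zero, one_smul, one_smul]
  | succ n ih =>
    intro P hP
    have hkP : k • P ∈ Φ := Φ.zsmul_mem hP k
    rw [pow_succ, mul_smul, hk P hP, ih _ hkP, smul_smul, ← pow_succ]

omit [W.IsElliptic] [Fact p.Prime] in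
/-- Iterating modulo a stable subgroup: `σⁿ • P - dⁿ • P ∈ Φ`. [folklore] -/
theorem pow_smul_sub_pow_zsmul_mem {Φ : AddSubgroup (geomTorsion W (p : ℤ))}
    {σ : absoluteGaloisGroup ℚ} (hstab : ∀ P ∈ Φ, σ • P ∈ Φ) {d : ℤ}
    (hd : ∀ P : geomTorsion W (p : ℤ), σ • P - d • P ∈ Φ) (n : ℕ) :
    ∀ P : geomTorsion W (p : ℤ), (σ ^ n) • P - (d ^ n) • P ∈ Φ := by
  induction n with
  | zero => intro P; rw [pow_zero, pow_zero, one_smul, one_smul, sub_self]; exact Φ.zero_mem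
  | succ n ih =>
    intro P
    -- `σ^{n+1} P - d^{n+1} P = σ^n (σ P - d P) + d (σ^n P - d^n P)`
    have hcalc : (σ ^ (n + 1)) • P - (d ^ (n + 1)) • P =
        (σ ^ n) • (σ • P - d • P) + d • ((σ ^ n) • P - (d ^ n) • P) := by
      rw [pow_succ, mul_smul, smul_sub, show (σ ^ n) • (d • P) = d • ((σ ^ n) • P) from
        map_zsmul (DistribSMul.toAddMonoidHom _ (σ ^ n)) d P, zsmul_sub, smul_smul d (d ^ n),
        mul_comm d, ← pow_succ]
      abel
    rw [hcalc]
    refine Φ.add_mem ?_ (Φ.zsmul_mem (ih P) d)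
    -- `σ^n` preserves `Φ`
    have hstabn : ∀ m : ℕ, ∀ Q ∈ Φ, (σ ^ m) • Q ∈ Φ := by
      intro m
      induction m with
      | zero => intro Q hQ; rwa [pow_zero, one_smul]
      | succ m ihm => intro Q hQ; rw [pow_succ, mul_smul]; exact ihm _ (hstab Q hQ)
    exact hstabn n _ (hd P)

omit [W.IsElliptic] [Fact p.Prime] in
/-- **A unipotent element has order dividing `p` on `E[p]`**: if `g` fixes `Φ` pointwise and acts
trivially on `E[p]/Φ`, then `g^p` fixes `E[p]` (`gᵐ P = P + m (g P - P)`). [folklore] -/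
theorem pow_prime_smul_eq_self_of_unipotent {Φ : AddSubgroup (geomTorsion W (p : ℤ))}
    {g : absoluteGaloisGroup ℚ} (hfix : ∀ P ∈ Φ, g • P = P)
    (hquot : ∀ P : geomTorsion W (p : ℤ), g • P - P ∈ Φ) (P : geomTorsion W (p : ℤ)) :
    (g ^ p) • P = P := by
  have hiter : ∀ m : ℕ, (g ^ m) • P = P + (m : ℤ) • (g • P - P) := by
    intro m
    induction m with
    | zero => rw [pow_zero, one_smul, Nat.cast_zero, zero_smul, add_zero]
    | succ m ih =>
      rw [pow_succ', mul_smul, ih, smul_add, show g • ((m : ℤ) • (g • P - P)) =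
        (m : ℤ) • (g • (g • P - P)) from map_zsmul (DistribSMul.toAddMonoidHom _ g) _ _,
        hfix _ (hquot P), Nat.cast_succ, add_smul, one_smul]
      abel
  rw [hiter p]
  have hp0 : ((p : ℕ) : ℤ) • (g • P - P) = 0 := by
    rw [← Subtype.coe_inj, AddSubgroupClass.coe_zsmul, ZeroMemClass.coe_zero]
    exact (Submodule.mem_torsionBy_iff _ _).mp (g • P - P).2
  rw [hp0, add_zero]

/-! ### Serre's Proposition 12: supersingular ⇒ irreducible -/

variable (W p) in
/-- **At an odd prime of good supersingular reduction, `E[p]` is irreducible** (Serre 1972, §1.11,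
Prop. 12). For `W/ℚ` globally minimal elliptic, `p ≠ 2`, `p ∤ Δ_W`, `p ∣ a_p`: no `Γ_ℚ`-stable line in
`E[p]`. The inertia group at the place's prime acts through a cyclic group of order `p² - 1`
(`isCyclic_and_card_inertia_map_of_dvd_frobeniusTrace` + the tame Kummer input
`exists_mem_inertia_smul_eq_mul_of_pow_eq`); a generator `ρ̄(τ)` would act on a stable line and on the
quotient by scalars `k, d ∈ 𝔽_pˣ`, so `τ^{p-1}` is unipotent (Fermat) and `τ^{p(p-1)}` is trivial on
`E[p]`: `p² - 1 ∣ p(p - 1) < p² - 1`, absurd. [cite: Serre1972, §1.11 Prop. 12] -/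
theorem hasIrreducibleModPGaloisRep_of_dvd_frobeniusTrace [W.IsGloballyMinimal] (hp2 : p ≠ 2)
    (hΔ : ¬ (p : ℤ) ∣ minimalDiscriminantInt W) (hss : (p : ℤ) ∣ W.frobeniusTrace p) :
    W.HasIrreducibleModPGaloisRep p := by
  have hp : p.Prime := Fact.out
  by_contra hred
  obtain ⟨Φ, hΦ⟩ := Rank1Residual.exists_isRationalLine_of_not_irr (W := W) (p := p) hred
  -- the place, its prime, and the cyclic image of inertia
  set v : HeightOneSpectrum (𝓞 ℚ) := primesEquiv.symm ⟨p, hp⟩ with hvdef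
  have hv : (primesEquiv v : ℕ) = p := by rw [hvdef, Equiv.apply_symm_apply]
  obtain ⟨𝔓, hmem, h𝔓⟩ := exists_ideal_placeOver p hv
  have hT : ∀ π ζ : AlgebraicClosure ℚ, π ^ (p ^ 2 - 1) = p → ζ ^ (p ^ 2 - 1) = 1 →
      ∃ s ∈ 𝔓.inertia (absoluteGaloisGroup ℚ), s • π = ζ * π := fun π ζ hπ hζ ↦
    exists_mem_inertia_smul_eq_mul_of_pow_eq p
      (Nat.sub_pos_of_lt (Nat.one_lt_pow two_ne_zero hp.one_lt)) hv h𝔓 hπ hζ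
  obtain ⟨hcyc, hcard⟩ := isCyclic_and_card_inertia_map_of_dvd_frobeniusTrace p hΔ hss hp2 hmem hT
  set G := (𝔓.inertia (absoluteGaloisGroup ℚ)).map (galoisRepTorsion W (p : ℤ)) with hGdef
  haveI := hcyc
  obtain ⟨g, hg⟩ := IsCyclic.exists_ofOrder_eq_natCard (α := G)
  obtain ⟨τ, hτI, hτg⟩ := Subgroup.mem_map.mp g.2
  have hordτ : orderOf (galoisRepTorsion W (p : ℤ) τ) = p ^ 2 - 1 := by
    rw [hτg, Subgroup.orderOf_coe, hg, hcard]
  -- scalars on `Φ` and on `E[p]/Φ`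
  have hE := Rank1Residual.natCard_geomTorsion W p
  have hstab : ∀ P ∈ Φ, τ • P ∈ Φ := hΦ.2 τ
  obtain ⟨k, hk⟩ := exists_smul_eq_zsmul_of_stable hΦ.1 hstab
  obtain ⟨d, hd⟩ := exists_smul_sub_zsmul_mem_of_stable hΦ.1 hE hstab
  -- `k` and `d` are prime to `p`
  haveI : Finite Φ := Nat.finite_of_card_ne_zero (by rw [hΦ.1]; exact hp.ne_zero)
  have hnt : 1 < Nat.card Φ := by rw [hΦ.1]; exact hp.one_lt
  haveI : Nontrivial Φ := Finite.one_lt_card_iff_nontrivial.mp hnt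
  obtain ⟨⟨P₀, hP₀⟩, hP₀0⟩ := exists_ne (0 : Φ)
  have hP₀0' : P₀ ≠ 0 := fun h ↦ hP₀0 (Subtype.ext h)
  have hptor : ∀ P : geomTorsion W (p : ℤ), ((p : ℕ) : ℤ) • P = 0 := fun P ↦ by
    rw [← Subtype.coe_inj, AddSubgroupClass.coe_zsmul, ZeroMemClass.coe_zero]
    exact (Submodule.mem_torsionBy_iff _ _).mp P.2
  have hkp : ¬ (p : ℤ) ∣ k := by
    rintro ⟨c, rfl⟩
    have h := hk P₀ hP₀
    rw [mul_comm, mul_smul, hptor, smul_zero] at h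
    exact hP₀0' ((smul_eq_zero_iff_eq τ).mp h)
  have hdp : ¬ (p : ℤ) ∣ d := by
    rintro ⟨c, rfl⟩
    -- then `τ • P ∈ Φ` for all `P`, so `Φ = ⊤`: contradiction with `#Φ = p < p²`
    have hall : ∀ P : geomTorsion W (p : ℤ), τ • P ∈ Φ := fun P ↦ by
      have h := hd P
      rwa [mul_comm, mul_smul, hptor, smul_zero, sub_zero] at h
    have htop : Φ = ⊤ := by
      refine eq_top_iff.mpr fun P _ ↦ ?_
      have := hall (τ⁻¹ • P)
      rwa [smul_inv_smul] at this
    have := hΦ.1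
    rw [htop, AddSubgroup.card_top, hE, pow_two] at this
    exact absurd this (by nlinarith [hp.one_lt])
  -- Fermat: `k^{p-1} ≡ 1`, `d^{p-1} ≡ 1 (mod p)`
  have hpi : Prime (p : ℤ) := Nat.prime_iff_prime_int.mp hp
  have hfermat : ∀ m : ℤ, ¬ (p : ℤ) ∣ m → ∀ P : geomTorsion W (p : ℤ), (m ^ (p - 1)) • P = P := by
    intro m hm P
    have h1 : m ^ (p - 1) ≡ 1 [ZMOD p] :=
      Int.ModEq.pow_card_sub_one_eq_one hp ((hpi.coprime_iff_not_dvd.mpr hm).symm)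
    obtain ⟨c, hc⟩ := (Int.modEq_iff_dvd.mp h1.symm)
    have h2 : m ^ (p - 1) = 1 + (p : ℤ) * c := by linarith
    rw [h2, add_smul, one_smul, mul_comm, mul_smul, hptor, smul_zero, add_zero]
  -- `g₀ = τ^{p-1}` is unipotent
  have hfix : ∀ P ∈ Φ, (τ ^ (p - 1)) • P = P := fun P hP ↦ by
    rw [pow_smul_eq_pow_zsmul hk (p - 1) P hP, hfermat k hkp P]
  have hquot : ∀ P : geomTorsion W (p : ℤ), (τ ^ (p - 1)) • P - P ∈ Φ := fun P ↦ by
    have h := pow_smul_sub_pow_zsmul_mem hstab hd (p - 1) P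
    rwa [hfermat d hdp P] at h
  -- so `τ^{(p-1)p}` is trivial on `E[p]`
  have htriv : ∀ P : geomTorsion W (p : ℤ), (τ ^ ((p - 1) * p)) • P = P := fun P ↦ by
    rw [pow_mul]; exact pow_prime_smul_eq_self_of_unipotent hfix hquot P
  have hone : galoisRepTorsion W (p : ℤ) (τ ^ ((p - 1) * p)) = 1 :=
    (galoisRepTorsion_eq_one_iff' W (p : ℤ) _).mpr htriv
  rw [map_pow] at hone
  have hdvd : p ^ 2 - 1 ∣ (p - 1) * p := hordτ ▸ orderOf_dvd_of_pow_eq_one hone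
  -- `p² - 1 ∣ p(p-1)` is absurd
  have hpos : 0 < (p - 1) * p := Nat.mul_pos (by have := hp.two_le; omega) hp.pos
  have hle := Nat.le_of_dvd hpos hdvd
  have h2 := hp.two_le
  have : p ^ 2 - 1 > (p - 1) * p := by
    have : (p - 1) * p = p ^ 2 - p := by rw [pow_two, Nat.sub_mul, one_mul]
    rw [this]; omega
  omega

end Literature.NumberTheory.EllipticCurves

/-! ### Consequences for the cell's good-Eisenstein line -/

namespace Literature.NumberTheory.EllipticCurves.Rank1Residual

variable {W : WeierstrassCurve ℚ} [W.IsElliptic] [W.IsGloballyMinimal] {p : ℕ} [Fact p.Prime]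

variable (W p) in
/-- **A good Eisenstein prime `p > 2` is ordinary**: `2 < p`, `good(p)`, `red(p)` ⇒ `ord(p)`
(RESIDUAL-CASES §a.1 C6; Serre 1972 §1.11 Prop. 12: at a supersingular prime `E[p]` is irreducible).
[cite: Serre1972, §1.11 Prop. 12] -/
theorem goodOrd_of_red_of_good (hp : 2 < p) (hgood : Good W p) (hred : Red W p) : GoodOrd W p := by
  refine ⟨hgood, fun hss ↦ hred ?_⟩
  exact hasIrreducibleModPGaloisRep_of_dvd_frobeniusTrace W p (by omega)
    (W.not_dvd_minimalDiscriminantInt_of_hasGoodReductionAtPrime' p hgood) hss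

/-- **The dictionary on exactly the scope of Castella–Grossi–Skinner 2025 Thm. A/D.** For `W/ℚ`
globally minimal elliptic, `2 < p` good, a rational line `Φ ⊂ E[p]` (the kernel of the rational
`p`-isogeny; `E[p]` reducible) and the decomposition group `D_𝔓` of the place's prime:
`Anom W p ⟺ (D_𝔓 fixes Φ pointwise) ∨ (D_𝔓 acts trivially on E[p]/Φ)` — ordinarity being automatic
(`goodOrd_of_red_of_good`). [cite: Serre1972, §1.11 Prop. 11–12] [cite: CastellaGrossiSkinner2025, Thm. A (hypothesis on φ), §0 p. 3] -/
theorem anom_iff_decomposition_of_good (hp : 2 < p) (hgood : Good W p)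
    {𝔓 : Ideal (absIntegers (𝓞 ℚ) ℚ)}
    (hmem : ∀ x : absIntegers (𝓞 ℚ) ℚ, x ∈ 𝔓 ↔ (x : AlgebraicClosure ℚ) ∈ (placeOver p).nonunits)
    {v : HeightOneSpectrum (𝓞 ℚ)} (hv : (primesEquiv v : ℕ) = p) (h𝔓 : 𝔓 ∈ v.primesAbove)
    {Φ : AddSubgroup (geomTorsion W (p : ℤ))} (hΦ : IsRationalLine W p Φ) :
    Anom W p ↔
      (∀ g ∈ 𝔓.decompositionSubgroup (absoluteGaloisGroup ℚ), ∀ P ∈ Φ, g • P = P) ∨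
      (∀ g ∈ 𝔓.decompositionSubgroup (absoluteGaloisGroup ℚ), ∀ P : geomTorsion W (p : ℤ),
        g • P - P ∈ Φ) := by
  have hred : Red W p := fun hirr ↦ by
    rcases hirr Φ hΦ.2 with h | h
    · have := hΦ.1; rw [h, AddSubgroup.card_bot] at this
      exact (Fact.out : p.Prime).one_lt.ne this
    · have h1 := hΦ.1
      rw [h, AddSubgroup.card_top, natCard_geomTorsion W p] at h1
      have : p ^ 2 = p ^ 1 := by rw [pow_one]; exact h1
      exact absurd (Nat.pow_right_injective (Fact.out : p.Prime).two_le this) (by norm_num)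
  exact anom_iff_decomposition hp (goodOrd_of_red_of_good W p hp hgood hred) hmem hv h𝔓 hΦ

/-- **`CGS25-anom-dictionary`, hypothesis-exact.** For `W/ℚ` globally minimal elliptic, a good prime
`p > 2`, `Φ` the kernel of a rational `p`-isogeny (a rational line) and `D_𝔓` a decomposition group at
`p` (the place's prime): Castella–Grossi–Skinner's "`φ|_{G_p} ≠ 1, ω`" — `D_𝔓` neither fixes `Φ`
pointwise nor acts trivially on `E[p]/Φ` — is EQUIVALENT to the census predicate `¬ Anom W p`
(`a_p ≢ 1 (mod p)`). [cite: CastellaGrossiSkinner2025, Thm. A (hypothesis on φ), §0 p. 3]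
[cite: Serre1972, §1.11 Prop. 11–12] -/
theorem not_anom_iff_cgs_of_good (hp : 2 < p) (hgood : Good W p)
    {𝔓 : Ideal (absIntegers (𝓞 ℚ) ℚ)}
    (hmem : ∀ x : absIntegers (𝓞 ℚ) ℚ, x ∈ 𝔓 ↔ (x : AlgebraicClosure ℚ) ∈ (placeOver p).nonunits)
    {v : HeightOneSpectrum (𝓞 ℚ)} (hv : (primesEquiv v : ℕ) = p) (h𝔓 : 𝔓 ∈ v.primesAbove)
    {Φ : AddSubgroup (geomTorsion W (p : ℤ))} (hΦ : IsRationalLine W p Φ) :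
    ¬ Anom W p ↔
      (¬ ∀ g ∈ 𝔓.decompositionSubgroup (absoluteGaloisGroup ℚ), ∀ P ∈ Φ, g • P = P) ∧
      (¬ ∀ g ∈ 𝔓.decompositionSubgroup (absoluteGaloisGroup ℚ), ∀ P : geomTorsion W (p : ℤ),
        g • P - P ∈ Φ) := by
  rw [anom_iff_decomposition_of_good hp hgood hmem hv h𝔓 hΦ, not_or]

/-! ### (append) Castella–Grossi–Skinner 2025 Thm. D with its PRINTED hypothesis ⇒ `BSD(E,p)` -/
omit [W.IsGloballyMinimal] in
/-- A rational line makes `E[p]` reducible: a stable subgroup of order `p` is neither `⊥` nor `⊤`. [folklore] -/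
theorem red_of_isRationalLine {Φ : AddSubgroup (geomTorsion W (p : ℤ))} (hΦ : IsRationalLine W p Φ) :
    Red W p := fun hirr ↦ by
  rcases hirr Φ hΦ.2 with h | h
  · have := hΦ.1; rw [h, AddSubgroup.card_bot] at this
    exact (Fact.out : p.Prime).one_lt.ne this
  · have h1 := hΦ.1
    rw [h, AddSubgroup.card_top, natCard_geomTorsion W p] at h1
    have : p ^ 2 = p ^ 1 := by rw [pow_one]; exact h1
    exact absurd (Nat.pow_right_injective (Fact.out : p.Prime).two_le this) (by norm_num)

/-- **Castella–Grossi–Skinner 2025, Theorem D, with its hypothesis AS PRINTED ⇒ Miller's `BSD(E,p)`.**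
For `W/ℚ` globally minimal elliptic with `ord_{s=1} L(E,s) ≤ 1`, a good prime `p > 2`, the kernel `Φ`
of a rational `p`-isogeny (a rational line: "`p` is Eisenstein") and a decomposition group `D_𝔓` at `p`
(the place's prime) with "`φ|_{G_p} ≠ 1, ω`" — `D_𝔓` neither fixes `Φ` pointwise nor acts trivially
on `E[p]/Φ` —: `BSDp W p`, from the fact `thmD_padicValRat_bsd_rank_le_one` (its `¬anom(p)` DERIVED
from the printed hypothesis, `not_anom_iff_cgs_of_good`), modularity, GZK; no torsion bit. Retires the
flag `CGS25-anom-dictionary` in the kernel. [cite: CastellaGrossiSkinner2025, Theorem D and Thm. A (hypothesis on φ)] -/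
theorem bsdp_of_thmD_of_cgs (hD : CastellaGrossiSkinner2025.thmD_padicValRat_bsd_rank_le_one)
    (hmod : hasEntireLFunction_rat) (hGZK : rank_eq_analyticRank_of_analyticRank_le_one)
    (hp : 2 < p) (hgood : Good W p)
    {𝔓 : Ideal (absIntegers (𝓞 ℚ) ℚ)}
    (hmem : ∀ x : absIntegers (𝓞 ℚ) ℚ, x ∈ 𝔓 ↔ (x : AlgebraicClosure ℚ) ∈ (placeOver p).nonunits)
    {v : HeightOneSpectrum (𝓞 ℚ)} (hv : (primesEquiv v : ℕ) = p) (h𝔓 : 𝔓 ∈ v.primesAbove)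
    {Φ : AddSubgroup (geomTorsion W (p : ℤ))} (hΦ : IsRationalLine W p Φ)
    (hφ1 : ¬ ∀ g ∈ 𝔓.decompositionSubgroup (absoluteGaloisGroup ℚ), ∀ P ∈ Φ, g • P = P)
    (hφω : ¬ ∀ g ∈ 𝔓.decompositionSubgroup (absoluteGaloisGroup ℚ), ∀ P : geomTorsion W (p : ℤ),
      g • P - P ∈ Φ)
    (hr : W.analyticRank ≤ 1) : BSDp W p :=
  bsdp_of_thmD_of_not_anom hD hmod hGZK W p hp hgood (red_of_isRationalLine hΦ)
    ((not_anom_iff_cgs_of_good hp hgood hmem hv h𝔓 hΦ).mpr ⟨hφ1, hφω⟩) hr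
end Literature.NumberTheory.EllipticCurves.Rank1Residual

end
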